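import Mathlib
import Summits.QuantumFields.YangMills.Theses.MirrorModularBoosts

/-!
# `PlanarSpectralCone` — negative-side support: the cone lever is sharp in the disc radius and in the cone

Support file for crux `stmt-QuantumFields-9664` (`MirrorModularBoosts.PlanarSpectralCone`), line
`two-mirror-lightcone-slots`, stub `stub_cone_of_discSections` ("disc sections of radius `t` with a
`t`-uniform bound force `μ{p₀ < |p₁|} = 0`"). Two explicit Dirac witnesses (drefute gen 3):

* `coneLever_false_at_radius`: if the disc radius `t` is shrunk to `κ t` with `κ < 1` (an "ε of opening
  angle" lost anywhere upstream), the lever is FALSE — the atom at the slow-light momentum `(κ, 1, 0, 0)`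
  has entire sections bounded by `1` on `|β| < κ t` for every `t`, and charges `{p₀ < |p₁|}`. So the full
  Thales radius `t` delivered by `stub_discSections_of_sectorExtension` is load-bearing: speed of light
  exactly `1` has no slack in this cut.
* `coneLever_boundary_charged`: the light-like atom `(1, 1, 0, 0)` meets the hypotheses of the lever
  EXACTLY as typed (radius `t`, bound `M = 1 = μ(univ)`) and charges the boundary `{p₀ = |p₁|}`; so the
  conclusion `μ{p₀ < |p₁|} = 0` (closed cone) cannot be strengthened to the open cone, and the constant
  `M = μ(univ)` is attained.
-/

namespace Summit.QuantumFields.YangMills.Theorems.PlanarSpectralCone.Negative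

open MeasureTheory Complex

noncomputable section

/-- The momentum `(c, 1, 0, 0)`. [folklore] -/
private theorem mom_apply (c : ℝ) :
    (EuclideanSpace.single (0 : Fin 4) c + EuclideanSpace.single (1 : Fin 4) (1 : ℝ) : EuclideanSpace ℝ (Fin 4)) 0 = c ∧
    (EuclideanSpace.single (0 : Fin 4) c + EuclideanSpace.single (1 : Fin 4) (1 : ℝ) : EuclideanSpace ℝ (Fin 4)) 1 = 1 := by
  constructor <;> simp

/-- The plane-wave section `z ↦ e^{-tc + iz}` is entire. [folklore] -/
private theorem differentiable_section (a : ℝ) :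
    Differentiable ℂ fun z : ℂ => Complex.exp (((a : ℝ) : ℂ) + z * Complex.I) := by
  fun_prop

/-- `‖e^{a + iz}‖ ≤ 1` as soon as `|z| ≤ -a`… precisely: `‖e^{a + iz}‖ = e^{a - Im z} ≤ 1` if `‖z‖ ≤ -a`.
[folklore] -/
private theorem norm_section_le_one {a : ℝ} {z : ℂ} (hz : ‖z‖ ≤ -a) :
    ‖Complex.exp (((a : ℝ) : ℂ) + z * Complex.I)‖ ≤ 1 := by
  rw [Complex.norm_exp]
  have hre : ((((a : ℝ) : ℂ) + z * Complex.I)).re = a - z.im := by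
    simp [Complex.add_re, Complex.mul_re, sub_eq_add_neg]
  rw [hre]
  have him : -z.im ≤ ‖z‖ := by
    have h1 : |z.im| ≤ ‖z‖ := Complex.abs_im_le_norm z
    have h2 : -z.im ≤ |z.im| := neg_le_abs z.im
    linarith
  have : a - z.im ≤ 0 := by linarith
  exact Real.exp_le_one_iff.mpr this

/-- **The lever `stub_cone_of_discSections` is false at any smaller disc radius `κ t`, `κ < 1`**: the Dirac
mass at the slow-light momentum `P = (κ, 1, 0, 0)` is finite, carried by `{p₀ ≥ 0}`, its Laplace–Fourier
sections `b ↦ ∫ e^{-tp₀ + ibp₁} dδ_P = e^{-tκ + ib}` extend to entire functions bounded by `1` on the disc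
`|β| < κ t` for EVERY `t > 0` (`|e^{-tκ+iβ}| = e^{-tκ - Im β} < 1` there), yet `δ_P {p₀ < |p₁|} = 1`.
Hence any loss of opening angle upstream (disc radius `κ t` instead of the Thales radius `t`) kills the
line: the cone with speed of light `1` needs the full radius. [folklore] -/
theorem coneLever_false_at_radius {κ : ℝ} (hκ0 : 0 < κ) (hκ1 : κ < 1) :
    ∃ μ : Measure (EuclideanSpace ℝ (Fin 4)), IsFiniteMeasure μ ∧ μ {p | p 0 < 0} = 0 ∧
      (∀ t : ℝ, 0 < t → ∃ f : ℂ → ℂ,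
        DifferentiableOn ℂ f (Metric.ball 0 (κ * t)) ∧
          (∀ z ∈ Metric.ball (0 : ℂ) (κ * t), ‖f z‖ ≤ 1) ∧
            ∀ b : ℝ, |b| < κ * t →
              f b = ∫ p, Complex.exp ((((-(t * p 0) : ℝ)) : ℂ) + ((b * p 1 : ℝ) : ℂ) * Complex.I) ∂μ) ∧
      μ {p | p 0 < |p 1|} ≠ 0 := by
  set P : EuclideanSpace ℝ (Fin 4) := EuclideanSpace.single (0 : Fin 4) κ + EuclideanSpace.single (1 : Fin 4) (1 : ℝ) with hP
  have hP0 : P 0 = κ := (mom_apply κ).1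
  have hP1 : P 1 = 1 := (mom_apply κ).2
  refine ⟨Measure.dirac P, inferInstance, ?_, ?_, ?_⟩
  · rw [Measure.dirac_apply]
    refine Set.indicator_of_notMem ?_ _
    simp only [Set.mem_setOf_eq, not_lt, hP0]
    exact hκ0.le
  · intro t ht
    refine ⟨fun z => Complex.exp ((((-(t * κ)) : ℝ) : ℂ) + z * Complex.I),
      (differentiable_section _).differentiableOn, ?_, ?_⟩
    · intro z hz
      refine norm_section_le_one ?_
      rw [Metric.mem_ball, dist_zero_right] at hz
      rw [neg_neg, mul_comm]
      exact hz.le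
    · intro b hb
      rw [integral_dirac]
      simp [hP0, hP1]
  · rw [Measure.dirac_apply_of_mem]
    · exact one_ne_zero
    · simp only [Set.mem_setOf_eq, hP0, hP1, abs_one]
      exact hκ1

/-- **The lever's hypotheses, exactly as typed, are met by a light-like atom**: the Dirac mass at
`P = (1, 1, 0, 0)` is finite, carried by `{p₀ ≥ 0}`, its sections `e^{-t + ib}` are entire and bounded by
`M = 1 = μ(univ)` on the full disc `|β| < t` for every `t > 0`, it satisfies the lever's conclusion
`μ{p₀ < |p₁|} = 0` — and it charges the boundary ray `{p₀ = |p₁|}`. So the closed cone in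
`stub_cone_of_discSections` / `stub_contractionFamily` cannot be sharpened to the open cone (no mass gap,
no timelike support comes out of the disc data), and the constant `M = μ(univ)` is attained. [folklore] -/
theorem coneLever_boundary_charged :
    ∃ μ : Measure (EuclideanSpace ℝ (Fin 4)), IsFiniteMeasure μ ∧ μ {p | p 0 < 0} = 0 ∧
      (∀ t : ℝ, 0 < t → ∃ f : ℂ → ℂ,
        DifferentiableOn ℂ f (Metric.ball 0 t) ∧
          (∀ z ∈ Metric.ball (0 : ℂ) t, ‖f z‖ ≤ 1) ∧
            ∀ b : ℝ, |b| < t →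
              f b = ∫ p, Complex.exp ((((-(t * p 0) : ℝ)) : ℂ) + ((b * p 1 : ℝ) : ℂ) * Complex.I) ∂μ) ∧
      μ {p | p 0 < |p 1|} = 0 ∧ μ {p | p 0 ≤ |p 1| ∧ p ≠ 0} ≠ 0 := by
  set P : EuclideanSpace ℝ (Fin 4) := EuclideanSpace.single (0 : Fin 4) (1 : ℝ) + EuclideanSpace.single (1 : Fin 4) (1 : ℝ)
    with hP
  have hP0 : P 0 = 1 := (mom_apply 1).1
  have hP1 : P 1 = 1 := (mom_apply 1).2
  have hPne : P ≠ 0 := by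
    intro h0
    have : P 0 = 0 := by rw [h0]; rfl
    rw [hP0] at this
    exact one_ne_zero this
  refine ⟨Measure.dirac P, inferInstance, ?_, ?_, ?_, ?_⟩
  · rw [Measure.dirac_apply]
    refine Set.indicator_of_notMem ?_ _
    simp only [Set.mem_setOf_eq, not_lt, hP0]
    exact zero_le_one
  · intro t ht
    refine ⟨fun z => Complex.exp ((((-(t * 1)) : ℝ) : ℂ) + z * Complex.I),
      (differentiable_section _).differentiableOn, ?_, ?_⟩
    · intro z hz
      refine norm_section_le_one ?_
      rw [Metric.mem_ball, dist_zero_right] at hz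
      rw [neg_neg, mul_one]
      exact hz.le
    · intro b hb
      rw [integral_dirac]
      simp [hP0, hP1]
  · rw [Measure.dirac_apply]
    refine Set.indicator_of_notMem ?_ _
    simp only [Set.mem_setOf_eq, hP0, hP1, abs_one, lt_self_iff_false, not_false_eq_true]
  · rw [Measure.dirac_apply_of_mem]
    · exact one_ne_zero
    · simp only [Set.mem_setOf_eq, hP0, hP1, abs_one, le_refl, true_and]
      exact hPne

end

end Summit.QuantumFields.YangMills.Theorems.PlanarSpectralCone.Negative
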